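import Literature.Probability.RandomGraphs.PlantedClique
import Literature.Probability.RandomGraphs.PlantedCliqueLowDegree
import Literature.Probability.RandomGraphs.LowDegree
import HarnessLib

/-!
# Planted clique: the equivalence class of the conjecture (Hirahara–Shimizu 2024) and the
optimality of low-degree distinguishers under it (Nagda–Raghavendra 2025)

NAMED FACTS (no proofs) in the vocabulary of `PlantedClique.lean` (`plantedCliqueDist n k` =
`G(n,1/2,k)` with a uniformly random `k`-subset planted — the FIXED-`k` model;
`erdosRenyiHalf n` = `G(n,1/2)`; `acceptProbOn`, `encodeEdgeVec`, `decodeVertexSet`; PPT =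
`RandAlg.IsPolyTime id _`) and of `PlantedCliqueLowDegree.lean` (`plantedBernoulliDist n k` =
`G̃(n,1/2,k) ≡ G(n,1/2,Bin(n,k/n))`, each vertex planted independently with probability `k/n` —
the BINOMIAL-`k` model) and `LowDegree.lean` (`lowDegreeLRSq P D = ‖L^{≤D}‖²`).

## 1. Hirahara–Shimizu, *Planted Clique Conjectures Are Equivalent* (STOC 2024)
[`HiraharaShimizu2024`; full version ECCC TR24-058, read: Conj. 1.1–1.2 p. 1–2, Thm 1.3 items
1–11 pp. 3–5, Thms 6.6, 6.7, 6.14–6.16 pp. 31–36, §9 p. 42]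

* Conj. 1.1 (p. 1, "the Planted Clique Conjecture with probability `ε(n)`", search / recovery,
  fixed-`k` model): "For any constant `α ∈ (0,1/2)` and for any randomized polynomial-time
  algorithm `A`, for all large `n ∈ ℕ` and for `k := n^{1/2-α}`, `A` cannot find a `k`-clique in
  `G(n,1/2,k)` with probability `ε(n)`. By default, we assume `ε(n) := 1/2`." Here "`A` finds a
  `k`-clique in `G(n,1/2,k)` with probability `ε(n)`" means
  `Pr_{A, G∼G(n,1/2,k)}[A outputs a clique of size k in G] ≥ ε(n)` (ANY `k`-clique, not
  necessarily the planted one) — `SearchHardWithProb ε` below (`findProb`), at `ε ≡ 1/2`.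
* Conj. 1.2 (p. 2, decision, adversarial-`k` model, advantage `ε(n,k) := 1/3` by default): "For
  any randomized polynomial-time algorithm `A`, for any constant `α > 0`, for all large `n ∈ ℕ`
  and for some `k ≥ n^{1/2-α}`,
  `|Pr_{A,G∼G(n,1/2,k)}[A(G)=1] − Pr_{A,G∼G(n,1/2)}[A(G)=1]| < ε(n,k)`" — `DecisionHardWithAdv ε` at `ε ≡ 1/3`.
* Thm 1.3: "The following (Items 1 to 11) are equivalent. 1. Conjecture 1.1 holds.
  2. Conjecture 1.2 holds. … 6. (A strong search version) For any constants `α ∈ (0,1/2)` and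
  `c > 0`, any randomized polynomial-time algorithm fails to find a `k`-clique in `G(n,1/2,k)`
  with probability `n^{-c}` for all large `n ∈ ℕ` and `k := n^{1/2-α}`. 7. (A strong decision
  version in the binomial-`k` model) For any constant `γ > 0`, for any randomized
  polynomial-time algorithm `A`, for all large `n ∈ ℕ` and for all `k ∈ ℕ`, distributions
  `G̃(n,1/2,k)` and `G(n,1/2)` cannot be distinguished by `A` with advantage `k²/n · n^γ`."
  (footnote 3: vacuous for `k > √n`) — `SearchHardWithProb (n ↦ n^{-c})`, `BinomialDecisionHardWithAdv`; the fact
  `HiraharaShimizu2024_equivalences` records 1 ⇔ 2 ⇔ 6 ⇔ 7 (Thm 6.6, 6.7, 6.14, 5.12).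
  The printed conjectures themselves are NOT asserted here: they appear only as parametrised
  statement shapes (like `PlantedCliqueRecoveryHard` / `PlantedCliqueDetectionHard`).
* NOT vendored (statement-level caveats recorded for the route): Item 9 (fixed-`k` strong
  decision: advantage `< min(√(k³/n)·n^γ, 1 − n^{-3})`) and the printed remark p. 5: "In the case
  of the fixed-`k` model, we obtain an advantage smaller than `o(1)` for any `k ≪ n^{1/3}`;
  however, for a technical reason, obtaining a small advantage for `n^{1/3} ≤ k ≪ n^{1/2}` is left
  open." — i.e. the weak-detection (vanishing advantage) form of the conjecture at every fixed
  `k(n) ≤ n^{1/2-ε}` (Brennan–Bresler–Huleihel 2018 Conj. 2.1; route decl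
  `PlantedClique.PlantedcliqueIndistinguishable`) is NOT among the printed equivalents on the
  window `n^{1/3} ≤ k ≤ n^{1/2-ε}`; it implies Conj. 1.2 trivially.

Rendering conventions (documented deviations, never stronger than print): `k := n^{1/2-α}` is
read `⌈n^{1/2-α}⌉₊`; algorithms receive `boolPair 1ⁿ (encodeEdgeVec G)` and answer with
indicator bits (`decodeVertexSet`) as everywhere in `PlantedClique.lean`; "randomized
polynomial-time" = `RandAlg.IsPolyTime` (uniform PPT, as in print: Remark 1.4 there treats the
non-uniform variant separately); "for all `k ∈ ℕ`" in Item 7 is read `1 ≤ k` (the paper's `ℕ`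
is the positive integers: at `k = 0` the two laws coincide and "advantage `< 0`" would be
absurd); advantages carry the absolute value, as restated in Nagda–Raghavendra Thm 1.2.

## 2. Nagda–Raghavendra, *On optimal distinguishers for Planted Clique* (FOCS 2025)
[`NagdaRaghavendra2025` = arXiv:2505.01990, read: Conj. 1.1, Thm 1.2, Thm 1.4, Cor. 1.5, Rem. 1.6
of §1] — binomial-`k` model throughout, advantage normalised as
`AlgAdv(A) := 2·|Pr_{x∼P}[A(x)=1] − Pr_{x∼Q}[A(x)=1]| ∈ [0,2]`, and for real test functions
`adv(f) := (E_P f − E_Q f)/√(E_Q f²)`, `adv[F_{≤d}] := sup` over polynomials of degree `≤ d`.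

* Conj. 1.1 (Planted Clique Hypothesis): "Let `α > 0` and set `k = n^{1/2-α}`. Let
  `Q = G(n,1/2)` and `P = G(n,1/2,k)` [binomial-`k`]. For every randomized polynomial time test
  `A` and all sufficiently large `n`, `AlgAdv(A) ≤ 1/4`." — the shape `BinomialAdvantageAtMost c`
  at `c = 1/8` (bound on `|Pr_P − Pr_Q|`), used only as the ANTECEDENT of the two facts below.
* Thm 1.4: "Assume the Planted Clique Hypothesis. Let `α > 0` and set `k = n^{1/2-α}`. Let
  `d ∈ ℕ` be a sufficiently large constant. … For every randomized polynomial time test `A`,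
  `AlgAdv(A) ≤ (1 + o_n(1)) · adv[F_{≤d}]`."  Cor. 1.5: "… `AlgAdv(A) ≤ (1+o_n(1)) · k²/(√π n)`."
  (Rem. 1.6: edge counting achieves `≈ k²/(√π n)`, so this is tight up to `1 + o(1)`.)
  On the cube with `Q` uniform, `adv[F_{≤d}] = ‖L^{≤d} − 1‖ = √(‖L^{≤d}‖² − 1)` (Parseval +
  Cauchy–Schwarz; Kunisky–Wein–Bandeira 2019 Prop. 1.15), i.e. `√(lowDegreeLRSq P d − 1)` in the
  tree's notation (`LowDegree.lean`: `lowDegreeLRSq P d = Σ_{|T| ≤ d} (E_P χ_T)²`, the `T = ∅`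
  term being `1`) — this closed form is what the facts below use.

Consumers. Grounds route PneNP/PlantedClique: target `PlantedcliqueThesis` (⇔ Conj. 1.1: it is
sandwiched between Item 6 and Item 1), cruxes `PlantedcliqueIndistinguishable` (⇒ Conj. 1.2;
converse printed only for `k ≤ n^{1/3-ε}`), `PlantedcliqueDetectionHard`, and the mechanism crux
`PlantedcliqueLowDegreePrediction` (Nagda–Raghavendra: for the clique family in the binomial
model at `k = n^{1/2-α}`, "efficient advantage ≤ (1+o(1)) · low-degree advantage" is a
CONSEQUENCE of the Planted Clique Hypothesis).

## References
* [HiraharaShimizu2024] S. Hirahara, N. Shimizu, Planted Clique Conjectures Are Equivalent,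
  STOC 2024, doi:10.1145/3618260.3649751; full version ECCC TR24-058.
* [NagdaRaghavendra2025] A. Nagda, P. Raghavendra, On optimal distinguishers for Planted Clique,
  FOCS 2025, arXiv:2505.01990.
* [BrennanBreslerHuleihel2018] arXiv:1806.07508, Conj. 2.1. [KuniskyWeinBandeira2019] Prop. 1.15.
-/

noncomputable section

namespace Literature.Probability.RandomGraphs.PlantedClique

open Literature.Computability.Complexity _root_.Computability Filter Topology Finset
open Literature.Probability.RandomGraphs.LowDegree

/-! ### Success probabilities -/

/-- `findProb A k n`: the probability, over `G ∼ G(n,1/2,k)` (fixed-`k` model) and the coins of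
`A`, that `A(1ⁿ, G)` outputs (the indicator string of) SOME clique of size `k` of `G` —
Hirahara–Shimizu's "`A` finds a `k`-clique in `G(n,1/2,k)`" (any `k`-clique, not necessarily the
planted set; compare `recoverProb`). [cite: HiraharaShimizu2024, §1 (definition before Conj. 1.1)] -/
def findProb (A : RandAlg (List Bool) (List Bool)) (k n : ℕ) : ℝ :=
  (((plantedCliqueDist n k).bind fun G =>
      (A.outputPMF id (boolPair (unaryEncodeNat n) (encodeEdgeVec G))).map fun w =>
        (G, decodeVertexSet n w)).toOuterMeasure
    {p | p.2.card = k ∧ (graphOfEdgeVec p.1).IsClique (p.2 : Set (Fin n))}).toReal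

/-- The (absolute) distinguishing advantage of a test `T` between two graph laws on `n`
vertices: `|Pr_{G∼P}[T(G)=1] − Pr_{G∼Q}[T(G)=1]|`. [cite: HiraharaShimizu2024, Conj. 1.2] -/
def advantage {n : ℕ} (T : RandAlg (List Bool) Bool) (P Q : PMF (EdgeVec n)) : ℝ :=
  |acceptProbOn T P - acceptProbOn T Q|

/-! ### Hirahara–Shimizu 2024: the parametrised hardness statements (NOT asserted) -/

/-- **Search hardness with probability `ε(n)`** (the family Hirahara–Shimizu call "the Planted
Clique Conj. with probability `ε(n)`", their 1.1; fixed-`k` model): "For any constant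
`α ∈ (0, 1/2)` and for any randomized polynomial-time algorithm `A`, for all large `n ∈ ℕ` and
for `k := n^{1/2-α}`, `A` cannot find a `k`-clique in `G(n,1/2,k)` with probability `ε(n)`"
(default `ε(n) := 1/2`; `k` read `⌈n^{1/2-α}⌉₊`). A statement SHAPE parametrised by `ε`, nothing
asserted (hypothesis / route vocabulary, like `PlantedCliqueRecoveryHard`).
[cite: HiraharaShimizu2024, Conj. 1.1] -/
def SearchHardWithProb (ε : ℕ → ℝ) : Prop :=
  ∀ α : ℝ, 0 < α → α < 1 / 2 → ∀ A : RandAlg (List Bool) (List Bool), A.IsPolyTime id id →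
    ∀ᶠ n : ℕ in atTop, findProb A ⌈(n : ℝ) ^ (1 / 2 - α)⌉₊ n < ε n

/-- **Decision hardness with advantage `ε(n,k)`, adversarial-`k` model** (Hirahara–Shimizu 1.2,
the decision version suggested by Saks; default `ε(n,k) := 1/3`): "For any randomized
polynomial-time algorithm `A`, for any constant `α > 0`, for all large `n ∈ ℕ` and for some
`k ≥ n^{1/2-α}`, `|Pr_{A,G∼G(n,1/2,k)}[A(G)=1] − Pr_{A,G∼G(n,1/2)}[A(G)=1]| < ε(n,k)`."
A statement SHAPE parametrised by `ε`, nothing asserted. [cite: HiraharaShimizu2024, Conj. 1.2] -/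
def DecisionHardWithAdv (ε : ℕ → ℕ → ℝ) : Prop :=
  ∀ A : RandAlg (List Bool) Bool, A.IsPolyTime id (fun b => [b]) → ∀ α : ℝ, 0 < α →
    ∀ᶠ n : ℕ in atTop, ∃ k : ℕ, (n : ℝ) ^ (1 / 2 - α) ≤ k ∧
      advantage A (plantedCliqueDist n k) (erdosRenyiHalf n) < ε n k

/-- **Decision hardness with advantage `ε(n,k)` in the binomial-`k` model, for every `k`**
(the shape of Hirahara–Shimizu Thm 1.3 item 7): "for any randomized polynomial-time algorithm
`A`, for all large `n ∈ ℕ` and for all `k ∈ ℕ`, distributions `G̃(n,1/2,k)` and `G(n,1/2)`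
cannot be distinguished by `A` with advantage `ε(n,k)`" (`G̃` = `plantedBernoulliDist`; `k ≥ 1`,
see the module docstring). A statement SHAPE, nothing asserted.
[cite: HiraharaShimizu2024, Thm. 1.3 (7)] -/
def BinomialDecisionHardWithAdv (ε : ℕ → ℕ → ℝ) : Prop :=
  ∀ A : RandAlg (List Bool) Bool, A.IsPolyTime id (fun b => [b]) →
    ∀ᶠ n : ℕ in atTop, ∀ k : ℕ, 1 ≤ k →
      advantage A (plantedBernoulliDist n k) (erdosRenyiHalf n) < ε n k

/-- **Hirahara–Shimizu 2024, Theorem 1.3 (items 1, 2, 6, 7): "The following are equivalent.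
1. [their 1.1, search with probability `1/2`] holds. 2. [their 1.2, decision with advantage `1/3`]
holds. … 6. (A strong search version) For any constants `α ∈ (0,1/2)` and `c > 0`, any
randomized polynomial-time algorithm fails to find a `k`-clique in `G(n,1/2,k)` with probability
`n^{-c}` for all large `n ∈ ℕ` and `k := n^{1/2-α}`. 7. (A strong decision version in the
binomial-`k` model) For any constant `γ > 0`, for any randomized polynomial-time algorithm `A`,
for all large `n ∈ ℕ` and for all `k ∈ ℕ`, distributions `G̃(n,1/2,k)` and `G(n,1/2)` cannot be
distinguished by `A` with advantage `k²/n · n^γ`."** Proved there by the shrinking and embedding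
reductions (Thm 6.6: 2 ⇔ 3 ⇔ 7 ⇔ 8; Thm 6.7: 1 ⇔ 4; Thm 5.12: 3 ⇔ 4; Thm 6.14: 1 ⇔ 6; §9).
A published THEOREM recorded as a named fact (no proof here); users take
`(h : HiraharaShimizu2024_equivalences)`. Grounds route PneNP/PlantedClique: its target
`PlantedcliqueThesis` sits between items 6 and 1, its crux `PlantedcliqueIndistinguishable`
implies item 2 (decls `Summit.PneNP.PneNP.Theses.PlantedClique.*`).
[cite: HiraharaShimizu2024, Thm. 1.3] -/
def HiraharaShimizu2024_equivalences : Prop :=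
  (SearchHardWithProb (fun _ => 1 / 2) ↔ DecisionHardWithAdv (fun _ _ => 1 / 3)) ∧
    (SearchHardWithProb (fun _ => 1 / 2) ↔
      ∀ c : ℝ, 0 < c → SearchHardWithProb (fun n => (n : ℝ) ^ (-c))) ∧
    (SearchHardWithProb (fun _ => 1 / 2) ↔
      ∀ γ : ℝ, 0 < γ → BinomialDecisionHardWithAdv (fun n k => (k : ℝ) ^ 2 / n * (n : ℝ) ^ γ))

/-! ### Nagda–Raghavendra 2025: low-degree tests are optimal under the hypothesis -/

/-- **Bounded-advantage hypothesis in the binomial-`k` model at `k = n^{1/2-α}`** (the shape of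
Nagda–Raghavendra's "Planted Clique Hypothesis", their 1.1, which is the case `c = 1/8`:
"Let `α > 0` and set `k = n^{1/2-α}`. Let `Q = G(n,1/2)` and `P = G(n,1/2,k)` [each vertex in
the planted set independently with probability `k/n`]. For every randomized polynomial time
test `A` and all sufficiently large `n`, `AlgAdv^{(P,Q)}(A) ≤ 1/4`", with
`AlgAdv(A) = 2·|Pr_P[A=1] − Pr_Q[A=1]|`; `k` read `⌈n^{1/2-α}⌉₊`). A statement SHAPE
parametrised by the bound `c` on `|Pr_P[A=1] − Pr_Q[A=1]|`, nothing asserted.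
[cite: NagdaRaghavendra2025, Conj. 1.1] -/
def BinomialAdvantageAtMost (c : ℝ) : Prop :=
  ∀ α : ℝ, 0 < α → ∀ A : RandAlg (List Bool) Bool, A.IsPolyTime id (fun b => [b]) →
    ∀ᶠ n : ℕ in atTop,
      advantage A (plantedBernoulliDist n ⌈(n : ℝ) ^ (1 / 2 - α)⌉₊) (erdosRenyiHalf n) ≤ c

/-- **Nagda–Raghavendra 2025, Theorem 1.4 (optimality of low-degree polynomials under the
Planted Clique Hypothesis).** "Assume the Planted Clique Hypothesis [`AlgAdv ≤ 1/4` at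
`k = n^{1/2-α}` for every `α > 0`, binomial-`k` model = `BinomialAdvantageAtMost (1/8)`]. Let
`α > 0` and set `k = n^{1/2-α}`. Let `d ∈ ℕ` be a sufficiently large constant. Let `Q = G(n,1/2)`
and `P = G(n,1/2,k)`. For every randomized polynomial time test `A`,
`AlgAdv^{(P,Q)}(A) ≤ (1 + o_n(1)) · adv^{(P,Q)}[F_{≤d}]`." Rendering: the low-degree advantage
`adv[F_{≤d}] = sup_{deg f ≤ d} (E_P f − E_Q f)/√(E_Q f²)` equals `√(‖L^{≤d}‖² − 1)`
`= √(lowDegreeLRSq P d − 1)` on the cube (Kunisky–Wein–Bandeira 2019 Prop. 1.15; Parseval), and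
`(1 + o_n(1))` is an `A`-dependent sequence `1 + η n`, `η → 0`. A published THEOREM
(conditional on the hypothesis, which appears as the antecedent) recorded as a named fact.
[cite: NagdaRaghavendra2025, Thm. 1.4] [cite: KuniskyWeinBandeira2019, Prop. 1.15] -/
def NagdaRaghavendra2025_lowDegree_optimal : Prop :=
  BinomialAdvantageAtMost (1 / 8) →
    ∀ α : ℝ, 0 < α → ∃ d₀ : ℕ, ∀ d : ℕ, d₀ ≤ d →
      ∀ A : RandAlg (List Bool) Bool, A.IsPolyTime id (fun b => [b]) →
        ∃ η : ℕ → ℝ, Tendsto η atTop (𝓝 0) ∧ ∀ᶠ n : ℕ in atTop,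
          2 * advantage A (plantedBernoulliDist n ⌈(n : ℝ) ^ (1 / 2 - α)⌉₊) (erdosRenyiHalf n) ≤
            (1 + η n) * Real.sqrt
              (lowDegreeLRSq (plantedBernoulliDist n ⌈(n : ℝ) ^ (1 / 2 - α)⌉₊) d - 1)

/-- **Nagda–Raghavendra 2025, Corollary 1.5 (the optimal advantage is `k²/(√π n)`).** "Assume
the Planted Clique Hypothesis. Let `α > 0` and set `k = n^{1/2-α}`. … For every randomized
polynomial time test `A`, `AlgAdv^{(P,Q)}(A) ≤ (1 + o_n(1)) · k²/(√π n)`" (tight: edge counting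
achieves `≈ k²/(√π n)`, Rem. 1.6). [cite: NagdaRaghavendra2025, Cor. 1.5 and Rem. 1.6] -/
def NagdaRaghavendra2025_optimal_advantage : Prop :=
  BinomialAdvantageAtMost (1 / 8) →
    ∀ α : ℝ, 0 < α → ∀ A : RandAlg (List Bool) Bool, A.IsPolyTime id (fun b => [b]) →
      ∃ η : ℕ → ℝ, Tendsto η atTop (𝓝 0) ∧ ∀ᶠ n : ℕ in atTop,
        2 * advantage A (plantedBernoulliDist n ⌈(n : ℝ) ^ (1 / 2 - α)⌉₊) (erdosRenyiHalf n) ≤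
          (1 + η n) * ((⌈(n : ℝ) ^ (1 / 2 - α)⌉₊ : ℝ) ^ 2 / (Real.sqrt Real.pi * n))

end Literature.Probability.RandomGraphs.PlantedClique
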